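import Mathlib
import HarnessLib
import Summits.Ventures.LatticeQCDFlow.Exactness.SUNResidualExponentLipschitz

/-!
# A-posteriori certificate for the residual layer's inverse pass: the last step bounds the error, `‖U_k − U⋆‖ ≤ ‖U_k − U_{k+1}‖ / (1 − κ)`

HONEST FRAMING: exact (Metropolis-corrected) sampling algorithms for lattice gauge theory;
figures of merit are autocorrelation/cost numbers at stated couplings and volumes; no
continuum-physics claim.

Venture `LatticeQCDFlow` (cell pub-lqcd), topic `Exactness`; FANOUT row 10 (`eng-equiv`, engine
`latflow.equiv`, `residual.ResidualCoupling.inverse`: "Inverse by fixed-point iteration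
`U^{(k+1)} = exp(−Q(U^{(k)})) U'` (geometric convergence at rate kappa); non-convergence raises"
— the loop stops when the step `delta = ‖U^{(k+1)} − U^{(k)}‖` drops below `tol`; the inverse
enters `log q` of GIVEN configurations, `flow.Flow.log_prob`).  NEW WORK of the cell over
`SUNResidualLayerContraction.lean` (bi-Lipschitz bound `(1 − κ)‖U − V‖ ≤ ‖Φ U − Φ V‖`) and
`SUNResidualExponentLipschitz.lean` (the engine's `κ = contraction_bound`); nothing is cited as a
fact; no number; no definition is introduced.  Printed counterpart, NAMED ONLY: the a-posteriori
error estimate of Banach's fixed-point theorem.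

## What is typed (`n` arbitrary; Frobenius norm)

* **`frobNorm_sub_preimage_le_step`** — for an exponent `Q : SU(n) → 𝔰𝔲(n)` that is
  `κ`-Lipschitz on `SU(n)`, a target `U' ∈ SU(n)` with pre-image `U⋆` (`e^{Q U⋆} U⋆ = U'`), and ANY
  `U ∈ SU(n)`: `(1 − κ) ‖U − U⋆‖_F ≤ ‖U − e^{−Q U} U'‖_F` — the distance to the true pre-image is
  controlled by the size of the NEXT fixed-point step, which the engine measures;
* `frobNorm_sub_preimage_le_step_div` — the same as `‖U − U⋆‖_F ≤ (1 − κ)⁻¹ ‖U − e^{−Q U} U'‖_F`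
  for `κ < 1`: stopping at `delta < tol` certifies the returned inverse to `tol / (1 − κ)`;
* **`frobNorm_sub_enginePreimage_le_step_div`** — the engine's exponent with polynomial staple
  weights, `κ = Σ_j Σ_k (1 + k)|a_jk| < 1` (`contraction_bound`).

NOT here: floating-point effects; any number.
-/

noncomputable section

namespace Summit.Ventures.LatticeQCDFlow.Exactness

open Literature.MathematicalPhysics.QuantumFieldTheory
open Literature.MathematicalPhysics.QuantumFieldTheory.Luscher2010
open scoped Matrix

variable {n : ℕ}

/-- **A-posteriori error bound for the inverse pass.**  `(1 − κ) ‖U − U⋆‖_F ≤ ‖U − e^{−Q U} U'‖_F`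
for every `U ∈ SU(n)`, where `U⋆` is the pre-image of `U'` under `U ↦ e^{Q U} U`: by the
bi-Lipschitz bound `(1 − κ)‖U − U⋆‖ ≤ ‖e^{Q U} U − e^{Q U⋆} U⋆‖ = ‖e^{Q U} U − U'‖`, and
`e^{Q U} U − U' = e^{Q U} (U − e^{−Q U} U')` with `e^{Q U}` unitary. -/
theorem frobNorm_sub_preimage_le_step {Q : Matrix (Fin n) (Fin n) ℂ → Matrix (Fin n) (Fin n) ℂ}
    {κ : ℝ} (hQ : ∀ U ∈ Matrix.specialUnitaryGroup (Fin n) ℂ, (Q U)ᴴ = -Q U ∧ (Q U).trace = 0)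
    (hlip : ∀ U ∈ Matrix.specialUnitaryGroup (Fin n) ℂ, ∀ V ∈ Matrix.specialUnitaryGroup (Fin n) ℂ,
      frobNorm (Q U - Q V) ≤ κ * frobNorm (U - V))
    {U Us U' : Matrix (Fin n) (Fin n) ℂ} (hU : U ∈ Matrix.specialUnitaryGroup (Fin n) ℂ)
    (hUs : Us ∈ Matrix.specialUnitaryGroup (Fin n) ℂ) (hfix : NormedSpace.exp (Q Us) * Us = U') :
    (1 - κ) * frobNorm (U - Us) ≤ frobNorm (U - NormedSpace.exp (-Q U) * U') := by
  have h := frobNorm_sub_le_of_residual hQ hlip hU hUs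
  rw [hfix] at h
  have hexpU : NormedSpace.exp (Q U) ∈ Matrix.unitaryGroup (Fin n) ℂ :=
    (Matrix.mem_specialUnitaryGroup_iff.mp (exp_mem_specialUnitaryGroup (hQ U hU).1 (hQ U hU).2)).1
  have hfactor : NormedSpace.exp (Q U) * U - U' =
      NormedSpace.exp (Q U) * (U - NormedSpace.exp (-Q U) * U') := by
    rw [Matrix.mul_sub, ← Matrix.mul_assoc, exp_mul_exp_neg, Matrix.one_mul]
  rw [hfactor, frobNorm_unitary_mul hexpU] at h
  exact h

/-- **The engine's stopping rule certifies the inverse**: for `κ < 1`,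
`‖U − U⋆‖_F ≤ (1 − κ)⁻¹ · ‖U − e^{−Q U} U'‖_F` — stopping the iteration when the step is below
`tol` returns a point within `tol/(1 − κ)` of the true pre-image. -/
theorem frobNorm_sub_preimage_le_step_div {Q : Matrix (Fin n) (Fin n) ℂ → Matrix (Fin n) (Fin n) ℂ}
    {κ : ℝ} (hκ : κ < 1)
    (hQ : ∀ U ∈ Matrix.specialUnitaryGroup (Fin n) ℂ, (Q U)ᴴ = -Q U ∧ (Q U).trace = 0)
    (hlip : ∀ U ∈ Matrix.specialUnitaryGroup (Fin n) ℂ, ∀ V ∈ Matrix.specialUnitaryGroup (Fin n) ℂ,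
      frobNorm (Q U - Q V) ≤ κ * frobNorm (U - V))
    {U Us U' : Matrix (Fin n) (Fin n) ℂ} (hU : U ∈ Matrix.specialUnitaryGroup (Fin n) ℂ)
    (hUs : Us ∈ Matrix.specialUnitaryGroup (Fin n) ℂ) (hfix : NormedSpace.exp (Q Us) * Us = U') :
    frobNorm (U - Us) ≤ (1 - κ)⁻¹ * frobNorm (U - NormedSpace.exp (-Q U) * U') := by
  have h1κ : 0 < 1 - κ := by linarith
  rw [le_inv_mul_iff₀ h1κ]
  exact frobNorm_sub_preimage_le_step hQ hlip hU hUs hfix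

/-- **The certificate for the engine's exponent** (polynomial staple weights, unitary staples,
`κ = Σ_j Σ_{k<K} (1 + k)|a_jk| < 1`): at any iterate `U ∈ SU(n)` of `ResidualCoupling.inverse`,
the distance to the true pre-image of `U'` is at most `(1 − κ)⁻¹` times the next step. -/
theorem frobNorm_sub_enginePreimage_le_step_div {ι : Type*} [Fintype ι] (a : ι → ℕ → ℝ) (K : ℕ)
    {C : ι → Matrix (Fin n) (Fin n) ℂ} (hC : ∀ j, C j ∈ Matrix.unitaryGroup (Fin n) ℂ)
    (hκ : ∑ j, ∑ k ∈ Finset.range K, (1 + (k : ℝ)) * |a j k| < 1)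
    {U Us U' : Matrix (Fin n) (Fin n) ℂ} (hU : U ∈ Matrix.specialUnitaryGroup (Fin n) ℂ)
    (hUs : Us ∈ Matrix.specialUnitaryGroup (Fin n) ℂ)
    (hfix : NormedSpace.exp (∑ j, ((∑ k ∈ Finset.range K, a j k * ((Us * C j).trace.re / n) ^ k : ℝ) : ℂ) •
        (-suProj (Us * C j))) * Us = U') :
    frobNorm (U - Us) ≤ (1 - ∑ j, ∑ k ∈ Finset.range K, (1 + (k : ℝ)) * |a j k|)⁻¹ *
      frobNorm (U - NormedSpace.exp (-∑ j, ((∑ k ∈ Finset.range K,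
        a j k * ((U * C j).trace.re / n) ^ k : ℝ) : ℂ) • (-suProj (U * C j))) * U') :=
  frobNorm_sub_preimage_le_step_div hκ (fun U _ => residualExponent_skew a K C U)
    (fun _ hU _ hV => frobNorm_residualExponent_sub_le a K hC
      (Matrix.mem_specialUnitaryGroup_iff.mp hU).1 (Matrix.mem_specialUnitaryGroup_iff.mp hV).1)
    hU hUs hfix

end Summit.Ventures.LatticeQCDFlow.Exactness
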